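import Literature.NumberTheory.GaloisCohomology.Howard2004.LevelQuotientProofs
import HarnessLib

/-!
# Howard 2004, Def. 1.2.1 / Rem. 1.2.4 — `I_ℓ`, `I_n`, `𝓛_k` under a change of coefficient ring

B. Howard, *The Heegner point Kolyvagin system*, Compos. Math. 140 (2004) (arXiv:1202.6340).
Rem. 1.2.4 (arXiv Rem. 2.2.4, p. 7, L13–27): «a Kolyvagin system for `T` induces one for
`T ⊗_R R/I` … the category `Quot(T)` and the ideals `I_ℓ`, `I_n` are compatible with the change of
rings `R → R/I`».  The cell's STUB 2 road (CGLS 2022 Thm. 4.1.1 gives `κ^{Hg} ∈ KS(𝐓, F_Λ, 𝓛_E)`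
over `R = Λ`; Thm. 1.6.1 is applied over the discrete valuation ring `S_m = Λ/(q_m)`) restricts a
Kolyvagin system along `Λ ↠ S_m` levelwise, i.e. along the surjections of LEVEL rings
`R_k ↠ R'_k = R_k/(q_m)` under which the free level `T^{(k)}` becomes `T^{(k)}/q_m T^{(k)}`.
For this one needs to know how the typed `I_ℓ = frobIdeal`, `I_n = levelIdeal`, `𝓛_k =
kolyvaginPrimes` (`SelmerTriples.lean` §D) behave under such a ring change.

Setting of this file: an algebra map `φ = algebraMap R R'`, an `R'`-module `N` read `R`-linearly
through `φ` (`IsScalarTower R R' N`), and — for the two-module statements — a presentation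
`h : IsQuotientBy ρ J ρ' π` of `N = T/JT` (`π : T →ₗ[R] N`, §E) with `J ≤ ker φ`.  Recall
(`FrobIdealProofs.lean`) that `frobIdeal (R := R) ρ v := sInf S_v(R, T)` has Howard's defining
property («`ℓ+1 ∈ I_ℓ` and `Frob_λ ≡ 1 mod I_ℓ T`», i.e. `frobIdeal ∈ S_v`) when `T` is free over
`R` (H.0) or `R` is a DVR with `ℓ+1 ≠ 0`, and NOT in general (the `Λ`-on-a-finite-level caveat
recorded there: over the SAME ring `R` the ideal `I_ℓ(T/JT)` can collapse).  This file proves,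
sorry-free, no definition, no instance:

§1 one module, two rings (`N` over `R'` and over `R` via `φ`):
* (private `restrictScalars_map_smul_top` — `(I.map φ) • N = I • N`, Mathlib's `Ideal.smul_restrictScalars`);
* `map_mem_frobIdealSet` / `comap_mem_frobIdealSet` — `I ∈ S_v(R, N) ⇒ I.map φ ∈ S_v(R', N)`, and
  for `φ` surjective `I' ∈ S_v(R', N) ⇒ I'.comap φ ∈ S_v(R, N)`;
* `map_frobIdeal_le_frobIdeal_of_surjective` — `(I_ℓ(R, N)).map φ ≤ I_ℓ(R', N)`;
  `frobIdeal_le_map_frobIdeal_of_mem'` / `frobIdeal_eq_map_frobIdeal_of_mem'` — `≥` / `=` when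
  `I_ℓ(R, N)` has its defining property (e.g. `R` a DVR: the D1 levels `T_q/p^k` over `S_m ↠ A_(m,k)`).

§2 two modules (`T` over `R`, `N = T/JT` over `R'`; `namespace IsQuotientBy`):
* `map_frobIdeal_le` — ALWAYS `(I_ℓ(R, T)).map φ ≤ I_ℓ(R', T/JT)` (`φ` surjective, `J ≤ ker φ`);
* `frobIdeal_le_map_frobIdeal_of_mem` — `I_ℓ(R', T/JT) ≤ (I_ℓ(R, T)).map φ` when `I_ℓ(R, T) ∈ S_v`
  (no surjectivity, no kernel hypothesis);
* **`frobIdeal_eq_map_frobIdeal_of_mem` / `_of_free` / `_of_h0`** — `I_ℓ(R', T/JT) = (I_ℓ(R, T)).map φ`;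
* **`frobIdeal_mem_ringChange_of_mem` / `_of_free` / `_of_h0`** — the defining property DESCENDS to
  `(R', T/JT)` (no freeness asked of `T/JT` over `R'`), whence `mem_kolyvaginPrimes_iff_ringChange_of_free`
  (Howard's `𝓛_k` unpacked downstairs) by `FrobIdealProofs.mem_kolyvaginPrimes_iff_of_mem`;
* **`levelIdeal_eq_map_levelIdeal_of_mem` / `_of_free` / `_of_h0`**, `map_levelIdeal_le` —
  `I_n(R', T/JT) = (I_n(R, T)).map φ`;
* `kolyvaginPrimes_subset_kolyvaginPrimes_ringChange_of_free` / `_of_h0` — `𝓛_k(R, T) ⊆ 𝓛_k(R', T/JT)`.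

§3 quotients in stages across the ring change:
* `comp_ringChange` — if `N'` presents `N/I'N` over `R'`, the composite `T ↠ N ↠ N'` presents
  `T/(I'.comap φ)T` over `R` (generalises `LevelQuotientProofs`' same-ring `comp`);
* **`comp_ringChange_levelIdeal_of_free` / `_of_h0`** — the downstairs Kolyvagin quotient
  `(T/JT)/I_n(R', T/JT)` is presented over `R` as `T/(I_n(R, T) ⊔ ker φ)T`; since
  `I_n(R, T) ≤ I_n(R, T) ⊔ ker φ`, it is a `transition`-quotient (§E) of the upstairs Kolyvagin
  quotient `T/I_n(R, T)T`, and `IsQuotientBy.transitionH1` pushes the classes `κ_n` forward — the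
  module half of Rem. 1.2.4's «induces».

§4 the same statements in the ring-change VIEW `IsQuotientBy.moduleQuotient` of `QuotFunctoriality.lean`
(`R' = R ⧸ J`, `φ = Ideal.Quotient.mk J`): `frobIdeal_moduleQuotient_eq_map_of_free`,
`levelIdeal_moduleQuotient_eq_map_of_free`, `frobIdeal_mem_moduleQuotient_of_free`,
`kolyvaginPrimes_subset_kolyvaginPrimes_moduleQuotient_of_free`.

## Main statements

* `IsQuotientBy.frobIdeal_eq_map_frobIdeal_of_free`, `IsQuotientBy.levelIdeal_eq_map_levelIdeal_of_free`,
  `IsQuotientBy.frobIdeal_mem_ringChange_of_free`, `IsQuotientBy.comp_ringChange_levelIdeal_of_free`.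
-/

set_option autoImplicit false

open Function NumberField IsDedekindDomain Field
open scoped NumberField ContRepresentation Classical

namespace Literature.NumberTheory.GaloisCohomology.Howard2004

open Literature.NumberTheory.GaloisRepresentations
open Literature.NumberTheory.GaloisRepresentations.DiscreteGaloisModule

section RingChange

variable {K : Type} [Field K] [NumberField K] {M : Type} [AddCommGroup M] [TopologicalSpace M]
  [DiscreteTopology M] {R : Type} [CommRing R] [Module R M]
  {R' : Type} [CommRing R'] [Algebra R R']
  {N : Type} [AddCommGroup N] [TopologicalSpace N] [DiscreteTopology N] [Module R N] [Module R' N]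
  [IsScalarTower R R' N]
  {N' : Type} [AddCommGroup N'] [TopologicalSpace N'] [DiscreteTopology N'] [Module R N']
  [Module R' N'] [IsScalarTower R R' N']

/-! ## 1. One module `N`, two coefficient rings `R → R'` -/

omit [TopologicalSpace N] [DiscreteTopology N] in
/-- `(I.map φ) • N = I • N` for an `R'`-module `N` read `R`-linearly through `φ = algebraMap R R'`
(Mathlib's `Ideal.smul_restrictScalars` at `⊤`). [folklore] -/
private theorem restrictScalars_map_smul_top (I : Ideal R) :
    ((I.map (algebraMap R R')) • (⊤ : Submodule R' N)).restrictScalars R =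
      I • (⊤ : Submodule R N) := by
  rw [Ideal.smul_restrictScalars, Submodule.restrictScalars_top]

/-- `S_v(R, N) ∋ I ⇒ S_v(R', N) ∋ I.map φ`: if `ℓ+1 ∈ I` and `Frob_λ ≡ 1 (mod I•N)` with `N` read over
`R`, then `ℓ+1 ∈ I.map φ` and `Frob_λ ≡ 1 (mod (I.map φ)•N)` over `R'` (any algebra map `φ`).
[cite: Howard2004HeegnerKolyvagin, Def. 1.2.1 and Rem. 1.2.4 (arXiv p. 6 L63–66, p. 7 L13–27)] -/
theorem map_mem_frobIdealSet (ρN : DiscreteGaloisModule K N) (v : HeightOneSpectrum (𝓞 K))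
    {I : Ideal R}
    (hI : ((residueChar v + 1 : ℕ) : R) ∈ I ∧
      ∀ σ : absoluteGaloisGroup K, IsArithFrobAtPlace K v σ →
        ∀ x : N, ρN σ x - x ∈ (I • (⊤ : Submodule R N) : Submodule R N)) :
    ((residueChar v + 1 : ℕ) : R') ∈ I.map (algebraMap R R') ∧
      ∀ σ : absoluteGaloisGroup K, IsArithFrobAtPlace K v σ →
        ∀ x : N, ρN σ x - x ∈
          ((I.map (algebraMap R R')) • (⊤ : Submodule R' N) : Submodule R' N) := by
  refine ⟨?_, fun σ hσ x => ?_⟩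
  · simpa only [map_natCast] using Ideal.mem_map_of_mem (algebraMap R R') hI.1
  · have hx := hI.2 σ hσ x
    rw [← restrictScalars_map_smul_top (R' := R') I, Submodule.restrictScalars_mem] at hx
    exact hx

/-- `S_v(R', N) ∋ I' ⇒ S_v(R, N) ∋ I'.comap φ` for `φ` SURJECTIVE: if `ℓ+1 ∈ I'` and
`Frob_λ ≡ 1 (mod I'•N)` over `R'`, then the same holds for `I'.comap φ` with `N` read over `R`
(`(I'.comap φ).map φ = I'`). [cite: Howard2004HeegnerKolyvagin, Def. 1.2.1 and Rem. 1.2.4 (arXiv p. 6 L63–66, p. 7 L13–27)] -/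
theorem comap_mem_frobIdealSet (hφ : Function.Surjective (algebraMap R R'))
    (ρN : DiscreteGaloisModule K N) (v : HeightOneSpectrum (𝓞 K)) {I' : Ideal R'}
    (hI' : ((residueChar v + 1 : ℕ) : R') ∈ I' ∧
      ∀ σ : absoluteGaloisGroup K, IsArithFrobAtPlace K v σ →
        ∀ x : N, ρN σ x - x ∈ (I' • (⊤ : Submodule R' N) : Submodule R' N)) :
    ((residueChar v + 1 : ℕ) : R) ∈ I'.comap (algebraMap R R') ∧
      ∀ σ : absoluteGaloisGroup K, IsArithFrobAtPlace K v σ →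
        ∀ x : N, ρN σ x - x ∈
          ((I'.comap (algebraMap R R')) • (⊤ : Submodule R N) : Submodule R N) := by
  refine ⟨?_, fun σ hσ x => ?_⟩
  · rw [Ideal.mem_comap, map_natCast]
    exact hI'.1
  · rw [← restrictScalars_map_smul_top (R' := R') (I'.comap (algebraMap R R')),
      Ideal.map_comap_of_surjective _ hφ, Submodule.restrictScalars_mem]
    exact hI'.2 σ hσ x

/-- **`(I_ℓ(R, N)).map φ ≤ I_ℓ(R', N)`** for `φ` surjective (one module, two rings).
[cite: Howard2004HeegnerKolyvagin, Def. 1.2.1 and Rem. 1.2.4 (arXiv p. 6 L63–66, p. 7 L13–27)] -/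
theorem map_frobIdeal_le_frobIdeal_of_surjective (hφ : Function.Surjective (algebraMap R R'))
    (ρN : DiscreteGaloisModule K N) (v : HeightOneSpectrum (𝓞 K)) :
    (frobIdeal (R := R) ρN v).map (algebraMap R R') ≤ frobIdeal (R := R') ρN v := by
  rw [Ideal.map_le_iff_le_comap]
  unfold frobIdeal
  rw [Ideal.comap_sInf]
  exact le_iInf₂ fun I' hI' => sInf_le (comap_mem_frobIdealSet hφ ρN v hI')

/-- `I_ℓ(R', N) ≤ (I_ℓ(R, N)).map φ` as soon as `I_ℓ(R, N)` has its defining property (e.g. `R` a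
discrete valuation ring with `ℓ+1 ≠ 0`, any `N` — `frobIdeal_mem_of_isDiscreteValuationRing`).
[cite: Howard2004HeegnerKolyvagin, Def. 1.2.1 and Rem. 1.2.4 (arXiv p. 6 L63–66, p. 7 L13–27)] -/
theorem frobIdeal_le_map_frobIdeal_of_mem' (ρN : DiscreteGaloisModule K N)
    (v : HeightOneSpectrum (𝓞 K))
    (hmem : ((residueChar v + 1 : ℕ) : R) ∈ frobIdeal (R := R) ρN v ∧
      ∀ σ : absoluteGaloisGroup K, IsArithFrobAtPlace K v σ →
        ∀ x : N, ρN σ x - x ∈ (frobIdeal (R := R) ρN v • (⊤ : Submodule R N) : Submodule R N)) :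
    frobIdeal (R := R') ρN v ≤ (frobIdeal (R := R) ρN v).map (algebraMap R R') :=
  frobIdeal_le_of_mem ρN v (map_mem_frobIdealSet ρN v hmem)

/-- **`I_ℓ(R', N) = (I_ℓ(R, N)).map φ`** for `φ` surjective when `I_ℓ(R, N)` has its defining
property — e.g. the D1 levels `T_q/p^k T_q` over the DVR `S_m` and over its level ring `S_m/(p^k)`.
[cite: Howard2004HeegnerKolyvagin, Def. 1.2.1 and Rem. 1.2.4 (arXiv p. 6 L63–66, p. 7 L13–27)] -/
theorem frobIdeal_eq_map_frobIdeal_of_mem' (hφ : Function.Surjective (algebraMap R R'))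
    (ρN : DiscreteGaloisModule K N) (v : HeightOneSpectrum (𝓞 K))
    (hmem : ((residueChar v + 1 : ℕ) : R) ∈ frobIdeal (R := R) ρN v ∧
      ∀ σ : absoluteGaloisGroup K, IsArithFrobAtPlace K v σ →
        ∀ x : N, ρN σ x - x ∈ (frobIdeal (R := R) ρN v • (⊤ : Submodule R N) : Submodule R N)) :
    frobIdeal (R := R') ρN v = (frobIdeal (R := R) ρN v).map (algebraMap R R') :=
  le_antisymm (frobIdeal_le_map_frobIdeal_of_mem' ρN v hmem)
    (map_frobIdeal_le_frobIdeal_of_surjective hφ ρN v)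

/-- DVR instance of the previous statement: `R` a discrete valuation ring of characteristic zero
(`ℤ_p`, `𝒪`, `S_m = Λ/(q_m)`), `N` ANY `R'`-module (e.g. a finite level over `R' = R/(p^k)`):
`I_ℓ(R', N) = (I_ℓ(R, N)).map φ`. [cite: Howard2004HeegnerKolyvagin, Def. 1.2.1 and §1.6 (arXiv p. 6 L63–66, p. 11 L13–16)] -/
theorem frobIdeal_eq_map_frobIdeal_of_isDiscreteValuationRing [IsDomain R]
    [IsDiscreteValuationRing R] [CharZero R] (hφ : Function.Surjective (algebraMap R R'))
    (ρN : DiscreteGaloisModule K N) (v : HeightOneSpectrum (𝓞 K)) :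
    frobIdeal (R := R') ρN v = (frobIdeal (R := R) ρN v).map (algebraMap R R') :=
  frobIdeal_eq_map_frobIdeal_of_mem' hφ ρN v
    (frobIdeal_mem_of_isDiscreteValuationRing_of_charZero ρN v)

/-! ## 2. Two modules: `T` over `R` (free), `N = T/JT` over `R' = R/J` -/

namespace IsQuotientBy

variable {ρ : DiscreteGaloisModule K M} {J : Ideal R} {ρ' : DiscreteGaloisModule K N}
  {π : M →ₗ[R] N}

omit [NumberField K] in
/-- `I • N = π(I • T)` for a presentation `π : T ↠ N`. [folklore] -/
private theorem smul_top_eq_map (h : IsQuotientBy ρ J ρ' π) (I : Ideal R) :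
    (I • (⊤ : Submodule R N) : Submodule R N) = Submodule.map π (I • (⊤ : Submodule R M)) := by
  rw [Submodule.map_smul'', Submodule.map_top, LinearMap.range_eq_top.mpr h.surjective]

omit [NumberField K] in
/-- For a presentation `π : T ↠ N = T/JT` and an ideal `I ⊇ J`: `π m ∈ I • N ↔ m ∈ I • T`. [folklore] -/
private theorem apply_mem_smul_top_iff (h : IsQuotientBy ρ J ρ' π) {I : Ideal R} (hJI : J ≤ I)
    (m : M) :
    π m ∈ (I • (⊤ : Submodule R N) : Submodule R N) ↔
      m ∈ (I • (⊤ : Submodule R M) : Submodule R M) := by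
  rw [h.smul_top_eq_map I, ← Submodule.mem_comap, Submodule.comap_map_eq, h.ker_eq,
    sup_eq_left.mpr (Submodule.smul_mono_left hJI)]

/-- `ker φ ≤ I'.comap φ`. [folklore] -/
private theorem ker_le_comap (I' : Ideal R') :
    RingHom.ker (algebraMap R R') ≤ I'.comap (algebraMap R R') :=
  (RingHom.ker_eq_comap_bot (algebraMap R R')).trans_le (Ideal.comap_mono bot_le)

/-- **ALWAYS `(I_ℓ(R, T)).map φ ≤ I_ℓ(R', T/JT)`** (`φ` surjective, `J ≤ ker φ`): for every
`I' ∈ S_v(R', T/JT)` the ideal `I'.comap φ ⊇ J` lies in `S_v(R, T)`, because a congruence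
`Frob_λ ≡ 1 (mod I'•(T/JT))` lifts to `Frob_λ ≡ 1 (mod (I'.comap φ)•T)`.
[cite: Howard2004HeegnerKolyvagin, Def. 1.2.1 and Rem. 1.2.4 (arXiv p. 6 L63–66, p. 7 L13–27)] -/
theorem map_frobIdeal_le (h : IsQuotientBy ρ J ρ' π)
    (hJ : J ≤ RingHom.ker (algebraMap R R')) (hφ : Function.Surjective (algebraMap R R'))
    (v : HeightOneSpectrum (𝓞 K)) :
    (frobIdeal (R := R) ρ v).map (algebraMap R R') ≤ frobIdeal (R := R') ρ' v := by
  rw [Ideal.map_le_iff_le_comap]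
  unfold frobIdeal
  rw [Ideal.comap_sInf]
  refine le_iInf₂ fun I' hI' => sInf_le ⟨?_, fun σ hσ m => ?_⟩
  · exact (comap_mem_frobIdealSet hφ ρ' v hI').1
  · rw [← h.apply_mem_smul_top_iff (hJ.trans (ker_le_comap I')) (ρ σ m - m), map_sub,
      h.equivariant]
    exact (comap_mem_frobIdealSet hφ ρ' v hI').2 σ hσ (π m)

/-- If `I_ℓ(R, T)` has its defining property (`T` free over `R`, or H.0, or `R` a DVR with
`ℓ+1 ≠ 0`), then **`I_ℓ(R', T/JT) ≤ (I_ℓ(R, T)).map φ`** — the congruence `Frob_λ ≡ 1 (mod I_ℓ T)`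
descends to `T/JT` (no surjectivity or kernel hypothesis needed).
[cite: Howard2004HeegnerKolyvagin, Def. 1.2.1 and Rem. 1.2.4 (arXiv p. 6 L63–66, p. 7 L13–27)] -/
theorem frobIdeal_le_map_frobIdeal_of_mem (h : IsQuotientBy ρ J ρ' π)
    (v : HeightOneSpectrum (𝓞 K))
    (hmem : ((residueChar v + 1 : ℕ) : R) ∈ frobIdeal (R := R) ρ v ∧
      ∀ σ : absoluteGaloisGroup K, IsArithFrobAtPlace K v σ →
        ∀ m : M, ρ σ m - m ∈ (frobIdeal (R := R) ρ v • (⊤ : Submodule R M) : Submodule R M)) :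
    frobIdeal (R := R') ρ' v ≤ (frobIdeal (R := R) ρ v).map (algebraMap R R') :=
  frobIdeal_le_of_mem ρ' v
    (map_mem_frobIdealSet ρ' v ⟨hmem.1, fun σ hσ x => h.sub_mem_smul_top (hmem.2 σ hσ) x⟩)

/-- **`I_ℓ(R', T/JT) = (I_ℓ(R, T)).map φ`** when `I_ℓ(R, T)` has its defining property
(`φ` surjective, `J ≤ ker φ`). [cite: Howard2004HeegnerKolyvagin, Def. 1.2.1 and Rem. 1.2.4 (arXiv p. 6 L63–66, p. 7 L13–27)] -/
theorem frobIdeal_eq_map_frobIdeal_of_mem (h : IsQuotientBy ρ J ρ' π)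
    (hJ : J ≤ RingHom.ker (algebraMap R R')) (hφ : Function.Surjective (algebraMap R R'))
    (v : HeightOneSpectrum (𝓞 K))
    (hmem : ((residueChar v + 1 : ℕ) : R) ∈ frobIdeal (R := R) ρ v ∧
      ∀ σ : absoluteGaloisGroup K, IsArithFrobAtPlace K v σ →
        ∀ m : M, ρ σ m - m ∈ (frobIdeal (R := R) ρ v • (⊤ : Submodule R M) : Submodule R M)) :
    frobIdeal (R := R') ρ' v = (frobIdeal (R := R) ρ v).map (algebraMap R R') :=
  le_antisymm (h.frobIdeal_le_map_frobIdeal_of_mem v hmem) (h.map_frobIdeal_le hJ hφ v)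

/-- **H.0 case: `I_ℓ(R', T/JT) = (I_ℓ(R, T)).map φ` for `T` free over `R`** — Howard's `I_ℓ` of
`T ⊗ R/J` is the image of the `I_ℓ` of `T` (`φ : R ↠ R'`, `J ≤ ker φ`).
[cite: Howard2004HeegnerKolyvagin, Def. 1.2.1, Rem. 1.2.4 and H.0 (arXiv p. 6 L63–66, p. 7)] -/
theorem frobIdeal_eq_map_frobIdeal_of_free [Module.Free R M] (h : IsQuotientBy ρ J ρ' π)
    (hJ : J ≤ RingHom.ker (algebraMap R R')) (hφ : Function.Surjective (algebraMap R R'))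
    (v : HeightOneSpectrum (𝓞 K)) :
    frobIdeal (R := R') ρ' v = (frobIdeal (R := R) ρ v).map (algebraMap R R') :=
  h.frobIdeal_eq_map_frobIdeal_of_mem hJ hφ v (frobIdeal_mem_of_free ρ v)

/-- H.0 by name: `I_ℓ(R', T/JT) = (I_ℓ(R, T)).map φ` under the tree's `H0 R T`.
[cite: Howard2004HeegnerKolyvagin, Def. 1.2.1, Rem. 1.2.4 and H.0 (arXiv p. 6 L63–66, p. 7)] -/
theorem frobIdeal_eq_map_frobIdeal_of_h0 (h0 : H0 R M) (h : IsQuotientBy ρ J ρ' π)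
    (hJ : J ≤ RingHom.ker (algebraMap R R')) (hφ : Function.Surjective (algebraMap R R'))
    (v : HeightOneSpectrum (𝓞 K)) :
    frobIdeal (R := R') ρ' v = (frobIdeal (R := R) ρ v).map (algebraMap R R') :=
  h.frobIdeal_eq_map_frobIdeal_of_mem hJ hφ v (frobIdeal_mem_of_h0 h0 ρ v)

/-- **The defining property descends.** If `I_ℓ(R, T)` has its defining property then so does
`I_ℓ(R', T/JT)`: `ℓ+1 ∈ I_ℓ(R', T/JT)` and `Frob_λ ≡ 1 (mod I_ℓ(R', T/JT)•(T/JT))` — with NO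
freeness asked of `T/JT` over `R'`. [cite: Howard2004HeegnerKolyvagin, Def. 1.2.1 and Rem. 1.2.4 (arXiv p. 6 L63–66, p. 7 L13–27)] -/
theorem frobIdeal_mem_ringChange_of_mem (h : IsQuotientBy ρ J ρ' π)
    (hJ : J ≤ RingHom.ker (algebraMap R R')) (hφ : Function.Surjective (algebraMap R R'))
    (v : HeightOneSpectrum (𝓞 K))
    (hmem : ((residueChar v + 1 : ℕ) : R) ∈ frobIdeal (R := R) ρ v ∧
      ∀ σ : absoluteGaloisGroup K, IsArithFrobAtPlace K v σ →
        ∀ m : M, ρ σ m - m ∈ (frobIdeal (R := R) ρ v • (⊤ : Submodule R M) : Submodule R M)) :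
    ((residueChar v + 1 : ℕ) : R') ∈ frobIdeal (R := R') ρ' v ∧
      ∀ σ : absoluteGaloisGroup K, IsArithFrobAtPlace K v σ →
        ∀ x : N, ρ' σ x - x ∈ (frobIdeal (R := R') ρ' v • (⊤ : Submodule R' N) : Submodule R' N) := by
  rw [h.frobIdeal_eq_map_frobIdeal_of_mem hJ hφ v hmem]
  exact map_mem_frobIdealSet ρ' v ⟨hmem.1, fun σ hσ x => h.sub_mem_smul_top (hmem.2 σ hσ) x⟩

/-- H.0 case of the descent: `T` free over `R` ⇒ `I_ℓ(R', T/JT)` has its defining property.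
[cite: Howard2004HeegnerKolyvagin, Def. 1.2.1, Rem. 1.2.4 and H.0 (arXiv p. 6 L63–66, p. 7)] -/
theorem frobIdeal_mem_ringChange_of_free [Module.Free R M] (h : IsQuotientBy ρ J ρ' π)
    (hJ : J ≤ RingHom.ker (algebraMap R R')) (hφ : Function.Surjective (algebraMap R R'))
    (v : HeightOneSpectrum (𝓞 K)) :
    ((residueChar v + 1 : ℕ) : R') ∈ frobIdeal (R := R') ρ' v ∧
      ∀ σ : absoluteGaloisGroup K, IsArithFrobAtPlace K v σ →
        ∀ x : N, ρ' σ x - x ∈ (frobIdeal (R := R') ρ' v • (⊤ : Submodule R' N) : Submodule R' N) :=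
  h.frobIdeal_mem_ringChange_of_mem hJ hφ v (frobIdeal_mem_of_free ρ v)

/-- H.0 by name: the defining property of `I_ℓ(R', T/JT)` under the tree's `H0 R T`.
[cite: Howard2004HeegnerKolyvagin, Def. 1.2.1, Rem. 1.2.4 and H.0 (arXiv p. 6 L63–66, p. 7)] -/
theorem frobIdeal_mem_ringChange_of_h0 (h0 : H0 R M) (h : IsQuotientBy ρ J ρ' π)
    (hJ : J ≤ RingHom.ker (algebraMap R R')) (hφ : Function.Surjective (algebraMap R R'))
    (v : HeightOneSpectrum (𝓞 K)) :
    ((residueChar v + 1 : ℕ) : R') ∈ frobIdeal (R := R') ρ' v ∧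
      ∀ σ : absoluteGaloisGroup K, IsArithFrobAtPlace K v σ →
        ∀ x : N, ρ' σ x - x ∈ (frobIdeal (R := R') ρ' v • (⊤ : Submodule R' N) : Submodule R' N) :=
  h.frobIdeal_mem_ringChange_of_mem hJ hφ v (frobIdeal_mem_of_h0 h0 ρ v)

/-- **Howard's `𝓛_k` unpacked downstairs** (`T` free over `R`): `λ ∈ 𝓛_k(R', T/JT)` iff `λ ∈ 𝓛₀(T/JT)`,
`ℓ+1 ∈ p^k R'` and `Frob_λ ≡ 1 (mod p^k (T/JT))` — the typed `kolyvaginPrimes` over the level ring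
`R'` is print-exact although `T/JT` need not be free over `R'` in the way the caveat of
`FrobIdealProofs` requires of `R`. [cite: Howard2004HeegnerKolyvagin, Def. 1.2.1 (arXiv p. 6, L67–68)] -/
theorem mem_kolyvaginPrimes_iff_ringChange_of_free [Module.Free R M] (h : IsQuotientBy ρ J ρ' π)
    (hJ : J ≤ RingHom.ker (algebraMap R R')) (hφ : Function.Surjective (algebraMap R R'))
    (p k : ℕ) (v : HeightOneSpectrum (𝓞 K)) :
    v ∈ kolyvaginPrimes (R := R') p ρ' k ↔
      (v ∈ degreeTwoPrimes p ρ' ∧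
        ((residueChar v + 1 : ℕ) : R') ∈ Ideal.span {((p : ℕ) : R') ^ k} ∧
        ∀ σ : absoluteGaloisGroup K, IsArithFrobAtPlace K v σ →
          ∀ x : N, ρ' σ x - x ∈
            ((Ideal.span {((p : ℕ) : R') ^ k}) • (⊤ : Submodule R' N) : Submodule R' N)) :=
  mem_kolyvaginPrimes_iff_of_mem p ρ' k v (h.frobIdeal_mem_ringChange_of_free hJ hφ v)

/-- ALWAYS `(I_n(R, T)).map φ ≤ I_n(R', T/JT)` (`φ` surjective, `J ≤ ker φ`).
[cite: Howard2004HeegnerKolyvagin, Def. 1.2.1 and Rem. 1.2.4 (arXiv p. 6 L73–75, p. 7 L13–27)] -/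
theorem map_levelIdeal_le (h : IsQuotientBy ρ J ρ' π)
    (hJ : J ≤ RingHom.ker (algebraMap R R')) (hφ : Function.Surjective (algebraMap R R'))
    (n : Finset (HeightOneSpectrum (𝓞 K))) :
    (levelIdeal (R := R) ρ n).map (algebraMap R R') ≤ levelIdeal (R := R') ρ' n := by
  unfold levelIdeal
  simp only [Ideal.map_iSup]
  exact iSup₂_mono fun v _ => h.map_frobIdeal_le hJ hφ v

/-- **`I_n(R', T/JT) = (I_n(R, T)).map φ`** when every `I_ℓ(R, T)`, `ℓ ∣ n`, has its defining
property (`φ` surjective, `J ≤ ker φ`). [cite: Howard2004HeegnerKolyvagin, Def. 1.2.1 and Rem. 1.2.4 (arXiv p. 6 L73–75, p. 7 L13–27)] -/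
theorem levelIdeal_eq_map_levelIdeal_of_mem (h : IsQuotientBy ρ J ρ' π)
    (hJ : J ≤ RingHom.ker (algebraMap R R')) (hφ : Function.Surjective (algebraMap R R'))
    (n : Finset (HeightOneSpectrum (𝓞 K)))
    (hmem : ∀ v ∈ n, ((residueChar v + 1 : ℕ) : R) ∈ frobIdeal (R := R) ρ v ∧
      ∀ σ : absoluteGaloisGroup K, IsArithFrobAtPlace K v σ →
        ∀ m : M, ρ σ m - m ∈ (frobIdeal (R := R) ρ v • (⊤ : Submodule R M) : Submodule R M)) :
    levelIdeal (R := R') ρ' n = (levelIdeal (R := R) ρ n).map (algebraMap R R') := by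
  refine le_antisymm ?_ (h.map_levelIdeal_le hJ hφ n)
  unfold levelIdeal
  simp only [Ideal.map_iSup]
  exact iSup₂_le fun v hv =>
    (h.frobIdeal_le_map_frobIdeal_of_mem v (hmem v hv)).trans
      (le_iSup₂ (f := fun w _ => (frobIdeal (R := R) ρ w).map (algebraMap R R')) v hv)

/-- **H.0 case: `I_n(R', T/JT) = (I_n(R, T)).map φ` for `T` free over `R`** («levelIdeal of the
quotient = image of levelIdeal»). [cite: Howard2004HeegnerKolyvagin, Def. 1.2.1, Rem. 1.2.4 and H.0 (arXiv p. 6 L73–75, p. 7)] -/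
theorem levelIdeal_eq_map_levelIdeal_of_free [Module.Free R M] (h : IsQuotientBy ρ J ρ' π)
    (hJ : J ≤ RingHom.ker (algebraMap R R')) (hφ : Function.Surjective (algebraMap R R'))
    (n : Finset (HeightOneSpectrum (𝓞 K))) :
    levelIdeal (R := R') ρ' n = (levelIdeal (R := R) ρ n).map (algebraMap R R') :=
  h.levelIdeal_eq_map_levelIdeal_of_mem hJ hφ n fun v _ => frobIdeal_mem_of_free ρ v

/-- H.0 by name: `I_n(R', T/JT) = (I_n(R, T)).map φ` under the tree's `H0 R T`.
[cite: Howard2004HeegnerKolyvagin, Def. 1.2.1, Rem. 1.2.4 and H.0 (arXiv p. 6 L73–75, p. 7)] -/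
theorem levelIdeal_eq_map_levelIdeal_of_h0 (h0 : H0 R M) (h : IsQuotientBy ρ J ρ' π)
    (hJ : J ≤ RingHom.ker (algebraMap R R')) (hφ : Function.Surjective (algebraMap R R'))
    (n : Finset (HeightOneSpectrum (𝓞 K))) :
    levelIdeal (R := R') ρ' n = (levelIdeal (R := R) ρ n).map (algebraMap R R') :=
  h.levelIdeal_eq_map_levelIdeal_of_mem hJ hφ n fun v _ => frobIdeal_mem_of_h0 h0 ρ v

/-- `𝓛_k(R, T) ∋ λ ⇒ 𝓛_k(R', T/JT) ∋ λ` when `I_ℓ(R, T)` has its defining property: `T/JT` is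
unramified where `T` is (`LevelQuotientProofs`), and `I_ℓ(R', T/JT) ≤ (I_ℓ(R, T)).map φ ≤ p^k R'`.
[cite: Howard2004HeegnerKolyvagin, Def. 1.2.1 and Rem. 1.2.4 (arXiv p. 6 L67–68, p. 7 L13–27)] -/
theorem mem_kolyvaginPrimes_ringChange_of_mem (h : IsQuotientBy ρ J ρ' π) (p k : ℕ)
    {v : HeightOneSpectrum (𝓞 K)} (hv : v ∈ kolyvaginPrimes (R := R) p ρ k)
    (hmem : ((residueChar v + 1 : ℕ) : R) ∈ frobIdeal (R := R) ρ v ∧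
      ∀ σ : absoluteGaloisGroup K, IsArithFrobAtPlace K v σ →
        ∀ m : M, ρ σ m - m ∈ (frobIdeal (R := R) ρ v • (⊤ : Submodule R M) : Submodule R M)) :
    v ∈ kolyvaginPrimes (R := R') p ρ' k := by
  refine ⟨h.degreeTwoPrimes_subset_degreeTwoPrimes p hv.1,
    (h.frobIdeal_le_map_frobIdeal_of_mem v hmem).trans ((Ideal.map_mono hv.2).trans ?_)⟩
  rw [Ideal.map_span, Set.image_singleton, map_pow, map_natCast]

/-- **H.0 case: `𝓛_k(R, T) ⊆ 𝓛_k(R', T/JT)` for `T` free over `R`.**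
[cite: Howard2004HeegnerKolyvagin, Def. 1.2.1, Rem. 1.2.4 and H.0 (arXiv p. 6 L67–68, p. 7)] -/
theorem kolyvaginPrimes_subset_kolyvaginPrimes_ringChange_of_free [Module.Free R M]
    (h : IsQuotientBy ρ J ρ' π) (p k : ℕ) :
    kolyvaginPrimes (R := R) p ρ k ⊆ kolyvaginPrimes (R := R') p ρ' k :=
  fun v hv => h.mem_kolyvaginPrimes_ringChange_of_mem p k hv (frobIdeal_mem_of_free ρ v)

/-- H.0 by name: `𝓛_k(R, T) ⊆ 𝓛_k(R', T/JT)` under the tree's `H0 R T`.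
[cite: Howard2004HeegnerKolyvagin, Def. 1.2.1, Rem. 1.2.4 and H.0 (arXiv p. 6 L67–68, p. 7)] -/
theorem kolyvaginPrimes_subset_kolyvaginPrimes_ringChange_of_h0 (h0 : H0 R M)
    (h : IsQuotientBy ρ J ρ' π) (p k : ℕ) :
    kolyvaginPrimes (R := R) p ρ k ⊆ kolyvaginPrimes (R := R') p ρ' k :=
  fun v hv => h.mem_kolyvaginPrimes_ringChange_of_mem p k hv (frobIdeal_mem_of_h0 h0 ρ v)

/-! ## 3. Quotients in stages across the ring change -/

omit [NumberField K] in
/-- **Stages across the ring change.** If `N` presents `T/JT` over `R` (`J ≤ ker φ`, `φ` surjective)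
and `N'` presents `N/I'N` over `R'`, then the composite `T ↠ N ↠ N'` presents `T/(I'.comap φ)T`
over `R` (generalises the same-ring `IsQuotientBy.comp`).
[cite: Howard2004HeegnerKolyvagin, Def. 1.1.3 and Rem. 1.2.4 (arXiv p. 5 L93–99, p. 7 L13–27)] -/
theorem comp_ringChange (h : IsQuotientBy ρ J ρ' π)
    (hJ : J ≤ RingHom.ker (algebraMap R R')) (hφ : Function.Surjective (algebraMap R R'))
    {I' : Ideal R'} {ρ'' : DiscreteGaloisModule K N'} {π' : N →ₗ[R'] N'}
    (h' : IsQuotientBy (R := R') ρ' I' ρ'' π') :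
    IsQuotientBy (R := R) ρ (I'.comap (algebraMap R R')) ρ'' ((π'.restrictScalars R).comp π) where
  surjective := h'.surjective.comp h.surjective
  ker_eq := by
    have key : (I' • (⊤ : Submodule R' N) : Submodule R' N).restrictScalars R =
        (I'.comap (algebraMap R R')) • (⊤ : Submodule R N) := by
      conv_lhs => rw [← Ideal.map_comap_of_surjective (algebraMap R R') hφ I']
      exact restrictScalars_map_smul_top _
    rw [LinearMap.ker_comp, LinearMap.ker_restrictScalars, h'.ker_eq, key, h.smul_top_eq_map,
      Submodule.comap_map_eq, h.ker_eq]
    exact sup_eq_left.mpr (Submodule.smul_mono_left (hJ.trans (ker_le_comap I')))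
  equivariant σ m := by
    rw [LinearMap.comp_apply, LinearMap.comp_apply, LinearMap.restrictScalars_apply,
      LinearMap.restrictScalars_apply, h.equivariant, h'.equivariant]

/-- **The downstairs Kolyvagin quotient as a quotient of `T`.** For `T` free over `R`: if `N'`
presents `(T/JT)/I_n(R', T/JT)·(T/JT)` over `R'` (a level of the RESTRICTED Selmer triple), then the
composite `T ↠ T/JT ↠ N'` presents `T/(I_n(R, T) ⊔ ker φ)T` over `R`.  Since
`I_n(R, T) ≤ I_n(R, T) ⊔ ker φ`, `N'` is the `IsQuotientBy.transition`-quotient of any presentation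
of the upstairs Kolyvagin quotient `T/I_n(R, T)T` (e.g. `LevelData.isQuotientBy n`), and
`transitionH1` carries `H¹(K, T/I_nT) → H¹(K, N')` — the module half of «a Kolyvagin system for `T`
induces one for `T ⊗ R/J`».
[cite: Howard2004HeegnerKolyvagin, Rem. 1.2.4 (arXiv Rem. 2.2.4, p. 7, L13–27)] -/
theorem comp_ringChange_levelIdeal_of_free [Module.Free R M] (h : IsQuotientBy ρ J ρ' π)
    (hJ : J ≤ RingHom.ker (algebraMap R R')) (hφ : Function.Surjective (algebraMap R R'))
    (n : Finset (HeightOneSpectrum (𝓞 K))) {ρ'' : DiscreteGaloisModule K N'} {π' : N →ₗ[R'] N'}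
    (h' : IsQuotientBy (R := R') ρ' (levelIdeal (R := R') ρ' n) ρ'' π') :
    IsQuotientBy (R := R) ρ (levelIdeal (R := R) ρ n ⊔ RingHom.ker (algebraMap R R')) ρ''
      ((π'.restrictScalars R).comp π) := by
  have hc := h.comp_ringChange hJ hφ h'
  rwa [h.levelIdeal_eq_map_levelIdeal_of_free hJ hφ n, Ideal.comap_map_of_surjective _ hφ,
    ← RingHom.ker_eq_comap_bot] at hc

/-- H.0 by name: the downstairs Kolyvagin quotient presents `T/(I_n(R, T) ⊔ ker φ)T` over `R`.
[cite: Howard2004HeegnerKolyvagin, Rem. 1.2.4 (arXiv Rem. 2.2.4, p. 7, L13–27)] -/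
theorem comp_ringChange_levelIdeal_of_h0 (h0 : H0 R M) (h : IsQuotientBy ρ J ρ' π)
    (hJ : J ≤ RingHom.ker (algebraMap R R')) (hφ : Function.Surjective (algebraMap R R'))
    (n : Finset (HeightOneSpectrum (𝓞 K))) {ρ'' : DiscreteGaloisModule K N'} {π' : N →ₗ[R'] N'}
    (h' : IsQuotientBy (R := R') ρ' (levelIdeal (R := R') ρ' n) ρ'' π') :
    IsQuotientBy (R := R) ρ (levelIdeal (R := R) ρ n ⊔ RingHom.ker (algebraMap R R')) ρ''
      ((π'.restrictScalars R).comp π) := by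
  haveI := h0.1
  exact h.comp_ringChange_levelIdeal_of_free hJ hφ n h'

/-- The transition from an upstairs Kolyvagin quotient `T/I_n(R,T)T` (any presentation `πq`) to the
downstairs one is compatible with the two presentations: `trans (πq m) = π' (π m)`.
[cite: Howard2004HeegnerKolyvagin, Rem. 1.2.4 (arXiv Rem. 2.2.4, p. 7, L13–27)] -/
theorem transition_ringChange_apply [Module.Free R M] (h : IsQuotientBy ρ J ρ' π)
    (hJ : J ≤ RingHom.ker (algebraMap R R')) (hφ : Function.Surjective (algebraMap R R'))
    (n : Finset (HeightOneSpectrum (𝓞 K))) {ρ'' : DiscreteGaloisModule K N'} {π' : N →ₗ[R'] N'}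
    (h' : IsQuotientBy (R := R') ρ' (levelIdeal (R := R') ρ' n) ρ'' π')
    {Nq : Type} [AddCommGroup Nq] [TopologicalSpace Nq] [DiscreteTopology Nq] [Module R Nq]
    {ρq : DiscreteGaloisModule K Nq} {πq : M →ₗ[R] Nq}
    (hq : IsQuotientBy (R := R) ρ (levelIdeal (R := R) ρ n) ρq πq) (m : M) :
    hq.transition (h.comp_ringChange_levelIdeal_of_free hJ hφ n h') le_sup_left (πq m) =
      π' (π m) :=
  hq.transition_apply _ le_sup_left m

end IsQuotientBy

end RingChange

/-! ## 4. The ring-change VIEW `IsQuotientBy.moduleQuotient` (`R' = R ⧸ J`, `φ = Ideal.Quotient.mk J`)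

`QuotFunctoriality.lean` reads an object `T/JT` of `Quot(T)` as an `R ⧸ J`-module through the
reducible, non-instance `IsQuotientBy.moduleQuotient`.  The statements of §2 specialise to that view
verbatim (the scalar tower `R → R ⧸ J → End(T/JT)` is Mathlib's `Module.IsTorsionBySet.isScalarTower`). -/

section ModuleQuotient

variable {K : Type} [Field K] [NumberField K] {M : Type} [AddCommGroup M] [TopologicalSpace M]
  [DiscreteTopology M] {R : Type} [CommRing R] [Module R M]
  {N : Type} [AddCommGroup N] [TopologicalSpace N] [DiscreteTopology N] [Module R N]
  {ρ : DiscreteGaloisModule K M} {J : Ideal R} {ρ' : DiscreteGaloisModule K N} {π : M →ₗ[R] N}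

/-- `J ≤ ker (R → R ⧸ J)` (in fact `=`, `Ideal.mk_ker`). [folklore] -/
private theorem le_ker_algebraMap_quotient (J : Ideal R) :
    J ≤ RingHom.ker (algebraMap R (R ⧸ J)) := by
  rw [Ideal.Quotient.algebraMap_eq, Ideal.mk_ker]

namespace IsQuotientBy

omit [NumberField K] in
/-- In the view `moduleQuotient`, `R → R ⧸ J → End(T/JT)` is a scalar tower. [folklore] -/
private theorem isScalarTower_moduleQuotient (h : IsQuotientBy ρ J ρ' π) :
    letI := h.moduleQuotient
    IsScalarTower R (R ⧸ J) N :=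
  Module.IsTorsionBySet.isScalarTower h.isTorsionBySet

/-- **`I_ℓ(R/J, T/JT) = (I_ℓ(R, T)).map (R → R/J)` for `T` free over `R`**, with `T/JT` read as an
`R ⧸ J`-module through `IsQuotientBy.moduleQuotient` — Howard's `I_ℓ` is «compatible with the change
of rings `R → R/I`». [cite: Howard2004HeegnerKolyvagin, Def. 1.2.1 and Rem. 1.2.4 (iii) (arXiv p. 6 L63–66, p. 7 L19–27)] -/
theorem frobIdeal_moduleQuotient_eq_map_of_free [Module.Free R M] (h : IsQuotientBy ρ J ρ' π)
    (v : HeightOneSpectrum (𝓞 K)) :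
    letI := h.moduleQuotient
    frobIdeal (R := R ⧸ J) ρ' v = (frobIdeal (R := R) ρ v).map (Ideal.Quotient.mk J) := by
  letI := h.moduleQuotient
  haveI := h.isScalarTower_moduleQuotient
  exact h.frobIdeal_eq_map_frobIdeal_of_free (R' := R ⧸ J) (le_ker_algebraMap_quotient J)
    Ideal.Quotient.mk_surjective v

/-- In the view `moduleQuotient`, `I_ℓ(R/J, T/JT)` has its defining property for `T` free over `R`:
`ℓ+1 ∈ I_ℓ` and `Frob_λ ≡ 1 (mod I_ℓ•(T/JT))`. [cite: Howard2004HeegnerKolyvagin, Def. 1.2.1 and Rem. 1.2.4 (iii) (arXiv p. 6 L63–66, p. 7 L19–27)] -/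
theorem frobIdeal_mem_moduleQuotient_of_free [Module.Free R M] (h : IsQuotientBy ρ J ρ' π)
    (v : HeightOneSpectrum (𝓞 K)) :
    letI := h.moduleQuotient
    ((residueChar v + 1 : ℕ) : R ⧸ J) ∈ frobIdeal (R := R ⧸ J) ρ' v ∧
      ∀ σ : absoluteGaloisGroup K, IsArithFrobAtPlace K v σ →
        ∀ x : N, ρ' σ x - x ∈
          (frobIdeal (R := R ⧸ J) ρ' v • (⊤ : Submodule (R ⧸ J) N) : Submodule (R ⧸ J) N) := by
  letI := h.moduleQuotient
  haveI := h.isScalarTower_moduleQuotient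
  exact h.frobIdeal_mem_ringChange_of_free (R' := R ⧸ J) (le_ker_algebraMap_quotient J)
    Ideal.Quotient.mk_surjective v

/-- **`I_n(R/J, T/JT) = (I_n(R, T)).map (R → R/J)` for `T` free over `R`** in the view
`moduleQuotient` («levelIdeal of `T/IT` = image of levelIdeal of `T`»).
[cite: Howard2004HeegnerKolyvagin, Def. 1.2.1 and Rem. 1.2.4 (iii) (arXiv p. 6 L73–75, p. 7 L19–27)] -/
theorem levelIdeal_moduleQuotient_eq_map_of_free [Module.Free R M] (h : IsQuotientBy ρ J ρ' π)
    (n : Finset (HeightOneSpectrum (𝓞 K))) :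
    letI := h.moduleQuotient
    levelIdeal (R := R ⧸ J) ρ' n = (levelIdeal (R := R) ρ n).map (Ideal.Quotient.mk J) := by
  letI := h.moduleQuotient
  haveI := h.isScalarTower_moduleQuotient
  exact h.levelIdeal_eq_map_levelIdeal_of_free (R' := R ⧸ J) (le_ker_algebraMap_quotient J)
    Ideal.Quotient.mk_surjective n

/-- `𝓛_k(R, T) ⊆ 𝓛_k(R/J, T/JT)` for `T` free over `R`, in the view `moduleQuotient`.
[cite: Howard2004HeegnerKolyvagin, Def. 1.2.1 and Rem. 1.2.4 (iii) (arXiv p. 6 L67–68, p. 7 L19–27)] -/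
theorem kolyvaginPrimes_subset_kolyvaginPrimes_moduleQuotient_of_free [Module.Free R M]
    (h : IsQuotientBy ρ J ρ' π) (p k : ℕ) :
    letI := h.moduleQuotient
    kolyvaginPrimes (R := R) p ρ k ⊆ kolyvaginPrimes (R := R ⧸ J) p ρ' k := by
  letI := h.moduleQuotient
  haveI := h.isScalarTower_moduleQuotient
  exact h.kolyvaginPrimes_subset_kolyvaginPrimes_ringChange_of_free (R' := R ⧸ J) p k

end IsQuotientBy

end ModuleQuotient

end Literature.NumberTheory.GaloisCohomology.Howard2004
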